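/-
Copyright: the b2b-balaban T⁴-continuum CRUX team, row NE7b leaf lineage `t4-ne7b-formalise-leaf-01` (gen 84). Project licence.
-/
import Mathlib.Analysis.SpecialFunctions.Exp
import Mathlib.Topology.Algebra.InfiniteSum.Real
import Literature.MathematicalPhysics.QuantumFieldTheory.Balaban1983to89.B2Lemma25Proof
import Summits.QuantumFields.BalabanUV.T4Continuum.Spine.NE7b.LatticeKernelDecayMoments
import Summits.QuantumFields.BalabanUV.T4Continuum.Spine.NE7b.LatticeKernelMomentsSummable

/-!
# THE LATTICE MOMENTS BY VALUE: on `ℤ^d`, `Σ' e^{−c‖x‖₁} ≤ (1 + 2∕c)^d`, `Σ' ‖x‖₁ⁿe^{−κ‖x‖₁} ≤ n!(2∕κ)ⁿ(1 + 4∕κ)^d`, and for a kernel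
# with the locality letter `|k x| ≤ Me^{−κ‖x‖₁}` every isotropic ∕ directional moment `≤ Eⁿ·M·n!(2∕κ)ⁿ(1 + 4∕κ)^d` — whence the
# momentum-smoothness letters of its symbol BY VALUE: `|Φ⁽ⁿ⁾| ≤ Eⁿ·M·n!(2∕κ)ⁿ(1 + 4∕κ)^d`, `K₄ = 384·E⁴Mκ⁻⁴(1 + 4∕κ)^d`, and the
# subtracted letter `|Φ(t) − ½Φ″(0)t²| ≤ 16·E⁴Mκ⁻⁴(1 + 4∕κ)^d·t⁴` (row NE7b, node U5c; the VALUES behind `…LatticeKernelDecayMoments` ∕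
# `…LatticeKernelMomentsSummable`; [folklore]: `sⁿe^{−cs} ≤ n!∕cⁿ` and the box-product bound `Σ_{x∈S} e^{−b|x|₁} ≤ (1 + 2∕b)^d`)

Cell `pub-balaban`, sub-cell `t4`, spine estimate NE7b (`T4WeightBudget.RelWeightBound`; the cell's OWN estimate — NOT PRINTED in
[Bałaban 1983–89], NOT PROVED).  Crux-route work under `Spine/NE7b/` by a row leaf (`t4-ne7b-formalise-leaf-01` gen 84) on the windowed
convexity road (R-P1) under FREEZE (0)'s crux-prover clause; NOTHING of Bałaban's is named as a Lean object, valued or asserted; no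
`T4Continuum/Support` leaf typed; no `def`; zero `sorry`.  Imports (all with hub oleans): the Literature's `….Balaban1983to89.B2Lemma25Proof`
(ONLY `l1dist` and the box-product bound `sum_exp_neg_l1dist_le` — `Σ_{x′∈S} e^{−b|x−x′|₁} ≤ (1 + 2∕b)^ν` for every finite `S ⊂ ℤ^ν` — BY NAME;
nothing of [B2]'s content is used), this row's `…LatticeKernelDecayMoments` (LKDM, leaf-06 g154: `pow_mul_exp_neg_mul_le`, `abs_sum_mul_le`,
`moments_of_decay_pi`) and `…LatticeKernelMomentsSummable` (LKMS, leaf-06 g153: `abs_iteratedDeriv_symbol_le`, `abs_symbol_sub_marginal_le`).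

WHY.  The power-counting thread of this road — `…InheritedHessianPowerCounting` (IHPC, leaf-01 g83: a kernel with no constant and no odd
terms is marginal, its subtracted part irrelevant, the inherited sum uniform in `k` GIVEN a fourth-derivative letter `K₄` per kernel),
`…LatticeKernelMoments` (LKM, leaf-01 g83, retry lane: the symbol's letters ARE the position-space moments, finite support), LKMS (infinite
support: `|Φ⁽ⁿ⁾| ≤ Σ' |k i|·|ω i|ⁿ`, the subtracted letter with `(Σ' |k|·ω⁴)∕24`), LKDM (on `ℤ^d` an exponential decay makes every moment
SUMMABLE) — stops one step short of a NUMBER: LKDM's NOT-HERE reads «explicit VALUES of the moments (only summability is typed; a value bound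
`Σ_x ‖x‖₁ⁿe^{−κ‖x‖₁} ≤ n!(2∕κ)ⁿ(Σ_m e^{−(κ∕2)|m|})^d` …)», IHPC's NOT-HERE reads «IN SHAPE the momentum-smoothness letter `K₄` of an inherited
kernel is LOCALITY of the term — the fourth moment of its position-space kernel, finite by a tree decay `e^{−κd}` … neither junction is typed
here», and the pricing desk lists «`(M, κ)`, `K₄`» among the letters owed BY VALUE (PRICING-NE7b §3).  THIS FILE supplies the values: the
lattice sums are bounded through their FINITE partial sums (`Real.tsum_le_of_sum_le`) by the Literature's box-product bound, so no product
formula for `tsum` over `ℤ^d` is needed, and the END is LKMS's two letters with every `Σ'` replaced by an explicit function of `(M, κ, E, d)`.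

WHAT IS PROVED ([folklore]; index `Fin d → ℤ`, `‖x‖₁ := Σ_j |x_j|` written inline as in LKDM; `ω x := Σ_j x_j e_j`):
* §1 THE ZEROTH MOMENT: `l1dist_zero_left` (`|0 − x|₁ = ‖x‖₁`), **`sum_exp_neg_norm1_le`** (`Σ_{x∈S} e^{−c‖x‖₁} ≤ (1 + 2∕c)^d` for EVERY finite
  `S`, `c > 0` — `B2Lemma25Proof.sum_exp_neg_l1dist_le` at the origin), **`tsum_exp_neg_norm1_le`** (`Σ' e^{−c‖x‖₁} ≤ (1 + 2∕c)^d`).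
* §2 THE `n`-TH MOMENT: `norm1_pow_mul_exp_neg_le` (termwise `‖x‖₁ⁿe^{−κ‖x‖₁} ≤ n!(2∕κ)ⁿe^{−(κ∕2)‖x‖₁}`), **`sum_norm1_pow_mul_exp_neg_le`** ∕
  **`tsum_norm1_pow_mul_exp_neg_le`** (`Σ_{x∈S}`, resp. `Σ'`, of `‖x‖₁ⁿe^{−κ‖x‖₁}` is `≤ n!(2∕κ)ⁿ(1 + 4∕κ)^d`, every `n`, `κ > 0`).
* §3 A DECAYING KERNEL (`hdecay : |k x| ≤ M·e^{−κ‖x‖₁}`): `size_nonneg_of_decay` (`0 ≤ M`), **`sum_moment_le_of_decay`** ∕ **`tsum_moment_le_of_decay`**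
  (`Σ |k x|·‖x‖₁ⁿ ≤ M·n!(2∕κ)ⁿ(1 + 4∕κ)^d`), **`tsum_directional_moment_le_of_decay`** (`|e_j| ≤ E`, `0 ≤ E` ⊢ `Σ' |k x|·|ω x|ⁿ ≤
  Eⁿ·M·n!(2∕κ)ⁿ(1 + 4∕κ)^d`).
* §4 THE END IN LKMS's CURRENCY, BY NAME: **`abs_iteratedDeriv_symbol_le_of_decay`** (`|Φ⁽ⁿ⁾(t)| ≤ Eⁿ·M·n!(2∕κ)ⁿ(1 + 4∕κ)^d` for the symbol
  `Φ(t) = Σ' k x·cos(ω x·t)`, EVERY `n`, every `t`), **`abs_iteratedDeriv_four_symbol_le_of_decay`** (THE (D) LETTER: `|Φ⁗(t)| ≤ 384·E⁴·M·κ⁻⁴·(1 + 4∕κ)^d`),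
  **`abs_symbol_sub_marginal_le_of_decay_pi`** (Ward letter `Σ' k = 0` ⊢ `|Φ(t) + ½(Σ' k·ω²)t²| ≤ 16·E⁴·M·κ⁻⁴·(1 + 4∕κ)^d·t⁴` — IHPC §6's
  remainder letter `|Rₙ q| ≤ C‖q‖⁴` with `C` a NAMED function of `(M, κ, E, d)`).
* §5 toys (kernel): `d = 0` (§1 reads `1 ≤ 1`); on `ℤ²` the kernel `½e^{−‖x‖₁}` has fourth isotropic moment `≤ ½·4!·2⁴·5² = 4800`.

NOT HERE (honest): the constants are not optimised (the sharp zeroth moment is `((1 + e^{−c})∕(1 − e^{−c}))^d`; the `2∕κ` comes from spending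
half the decay on the polynomial weight); form-valued kernels; the index is `Fin d → ℤ` (LKDM ∕ LKMS are stated for any finite `ι` — specialise
them at `ι := Fin d`, or transport along `Fintype.equivFin`); the junction with IHPC ∕ LKM BY IMPORT (no hub olean); WHICH kernels print's
inherited terms have and their `(M, κ)` BY VALUE ([B12] (1.18) read BY SHAPE only; (A3) ∕ (A1c), NC-NE7b-α UNRULED); anything of Bałaban's.
BY-NAME EFFECT ON THE WALL: NONE (a displayed letter of a displayed letter is now a number; the wall is (R2)).  NE7b NOT PRINTED ∕ NOT PROVED;
spine PROVED 0∕9; rung (B)+1 on a FINITE torus — NOT infinite volume, NOT the mass gap, NOT Clay.  HONEST DEPENDENCY: continuum YM on T⁴ ⇐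
BetaPertH ∧ nine spine estimates (0∕9 proved); BetaPertH ⇐ (D1) ∧ (D4) ∧ CAP+tail; G-an2-4 gates asym, D1 and NE2∕3∕4.
-/

set_option autoImplicit false

noncomputable section

open Real Finset
open scoped Nat

namespace Summit.QuantumFields.BalabanUV.T4Continuum.NE7b.LatticeKernelMomentValues

open Literature.MathematicalPhysics.QuantumFieldTheory.Balaban1983to89.B2Lemma25Proof (l1dist sum_exp_neg_l1dist_le)
open Summit.QuantumFields.BalabanUV.T4Continuum.NE7b.LatticeKernelDecayMoments (pow_mul_exp_neg_mul_le abs_sum_mul_le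
  moments_of_decay_pi)
open Summit.QuantumFields.BalabanUV.T4Continuum.NE7b.LatticeKernelMomentsSummable (abs_iteratedDeriv_symbol_le
  abs_symbol_sub_marginal_le)

variable {d : ℕ}

/-! ## §1 The zeroth moment by value: `Σ_{x ∈ ℤ^d} e^{−c‖x‖₁} ≤ (1 + 2∕c)^d` -/

/-- `|0 − x|₁ = ‖x‖₁`: the Literature's `l1dist` from the origin is the inline `ℓ¹` norm of `…LatticeKernelDecayMoments`. -/
theorem l1dist_zero_left (x : Fin d → ℤ) : l1dist 0 x = ∑ j, |(x j : ℝ)| := by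
  unfold l1dist
  refine sum_congr rfl fun j _ => ?_
  rw [Pi.zero_apply, zero_sub, Int.cast_neg, abs_neg]

/-- **FINITE PARTIAL SUMS**: for `c > 0` and ANY finite `S ⊂ ℤ^d`, `Σ_{x ∈ S} e^{−c‖x‖₁} ≤ (1 + 2∕c)^d` — the Literature's box-product
bound `B2Lemma25Proof.sum_exp_neg_l1dist_le` BY NAME at the origin. [folklore] -/
theorem sum_exp_neg_norm1_le {c : ℝ} (hc : 0 < c) (S : Finset (Fin d → ℤ)) :
    ∑ x ∈ S, exp (-c * ∑ j, |(x j : ℝ)|) ≤ (1 + 2 / c) ^ d := by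
  have h := sum_exp_neg_l1dist_le hc 0 S
  calc ∑ x ∈ S, exp (-c * ∑ j, |(x j : ℝ)|) = ∑ x ∈ S, exp (-(c * l1dist 0 x)) :=
        sum_congr rfl fun x _ => by rw [l1dist_zero_left, neg_mul]
    _ ≤ (1 + 2 / c) ^ d := h

/-- **THE ZEROTH MOMENT BY VALUE**: `Σ'_{x ∈ ℤ^d} e^{−c‖x‖₁} ≤ (1 + 2∕c)^d` for `c > 0` (the `tsum` is bounded by the bound of its
finite partial sums, `Real.tsum_le_of_sum_le`). [folklore] -/
theorem tsum_exp_neg_norm1_le {c : ℝ} (hc : 0 < c) :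
    ∑' x : Fin d → ℤ, exp (-c * ∑ j, |(x j : ℝ)|) ≤ (1 + 2 / c) ^ d :=
  Real.tsum_le_of_sum_le (fun _ => (exp_pos _).le) (sum_exp_neg_norm1_le hc)

/-! ## §2 The `n`-th moments by value: `Σ_{x ∈ ℤ^d} ‖x‖₁ⁿ e^{−κ‖x‖₁} ≤ n!(2∕κ)ⁿ(1 + 4∕κ)^d` -/

/-- Termwise: `‖x‖₁ⁿ·e^{−κ‖x‖₁} ≤ n!(2∕κ)ⁿ·e^{−(κ∕2)‖x‖₁}` (`sⁿe^{−(κ∕2)s} ≤ n!∕(κ∕2)ⁿ`, `…LatticeKernelDecayMoments.pow_mul_exp_neg_mul_le`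
BY NAME). [folklore] -/
theorem norm1_pow_mul_exp_neg_le {κ : ℝ} (hκ : 0 < κ) (n : ℕ) (x : Fin d → ℤ) :
    (∑ j, |(x j : ℝ)|) ^ n * exp (-κ * ∑ j, |(x j : ℝ)|) ≤ n ! * (2 / κ) ^ n * exp (-(κ / 2) * ∑ j, |(x j : ℝ)|) := by
  set S : ℝ := ∑ j, |(x j : ℝ)| with hS
  have hs : 0 ≤ S := sum_nonneg fun j _ => abs_nonneg _
  have h1 : S ^ n * exp (-(κ / 2) * S) ≤ n ! / (κ / 2) ^ n := pow_mul_exp_neg_mul_le (half_pos hκ) n hs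
  have hsplit : exp (-κ * S) = exp (-(κ / 2) * S) * exp (-(κ / 2) * S) := by
    rw [← Real.exp_add]
    ring_nf
  have e : (n ! : ℝ) / (κ / 2) ^ n = n ! * (2 / κ) ^ n := by
    rw [div_eq_mul_inv, ← inv_pow, inv_div]
  calc S ^ n * exp (-κ * S) = S ^ n * exp (-(κ / 2) * S) * exp (-(κ / 2) * S) := by rw [hsplit, mul_assoc]
    _ ≤ n ! / (κ / 2) ^ n * exp (-(κ / 2) * S) := mul_le_mul_of_nonneg_right h1 (exp_pos _).le
    _ = n ! * (2 / κ) ^ n * exp (-(κ / 2) * S) := by rw [e]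

/-- **FINITE PARTIAL SUMS OF THE `n`-TH MOMENT**: `Σ_{x ∈ S} ‖x‖₁ⁿe^{−κ‖x‖₁} ≤ n!(2∕κ)ⁿ(1 + 4∕κ)^d` for every finite `S ⊂ ℤ^d`. [folklore] -/
theorem sum_norm1_pow_mul_exp_neg_le {κ : ℝ} (hκ : 0 < κ) (n : ℕ) (S : Finset (Fin d → ℤ)) :
    ∑ x ∈ S, (∑ j, |(x j : ℝ)|) ^ n * exp (-κ * ∑ j, |(x j : ℝ)|) ≤ n ! * (2 / κ) ^ n * (1 + 4 / κ) ^ d := by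
  have hκ0 : κ ≠ 0 := hκ.ne'
  have h4 : (1 : ℝ) + 2 / (κ / 2) = 1 + 4 / κ := by
    field_simp
    ring
  calc ∑ x ∈ S, (∑ j, |(x j : ℝ)|) ^ n * exp (-κ * ∑ j, |(x j : ℝ)|)
      ≤ ∑ x ∈ S, n ! * (2 / κ) ^ n * exp (-(κ / 2) * ∑ j, |(x j : ℝ)|) :=
        sum_le_sum fun x _ => norm1_pow_mul_exp_neg_le hκ n x
    _ = n ! * (2 / κ) ^ n * ∑ x ∈ S, exp (-(κ / 2) * ∑ j, |(x j : ℝ)|) := by rw [mul_sum]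
    _ ≤ n ! * (2 / κ) ^ n * (1 + 2 / (κ / 2)) ^ d :=
        mul_le_mul_of_nonneg_left (sum_exp_neg_norm1_le (half_pos hκ) S) (by positivity)
    _ = n ! * (2 / κ) ^ n * (1 + 4 / κ) ^ d := by rw [h4]

/-- **THE `n`-TH MOMENT BY VALUE**: `Σ'_{x ∈ ℤ^d} ‖x‖₁ⁿ e^{−κ‖x‖₁} ≤ n!(2∕κ)ⁿ(1 + 4∕κ)^d` for `κ > 0` and EVERY `n` — the value that
`…LatticeKernelDecayMoments.summable_norm1_pow_mul_exp_neg` leaves untyped («only summability is typed»). [folklore] -/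
theorem tsum_norm1_pow_mul_exp_neg_le {κ : ℝ} (hκ : 0 < κ) (n : ℕ) :
    ∑' x : Fin d → ℤ, (∑ j, |(x j : ℝ)|) ^ n * exp (-κ * ∑ j, |(x j : ℝ)|) ≤ n ! * (2 / κ) ^ n * (1 + 4 / κ) ^ d :=
  Real.tsum_le_of_sum_le (fun x => by positivity) (sum_norm1_pow_mul_exp_neg_le hκ n)

/-! ## §3 A decaying kernel's moments by value: `|k x| ≤ M e^{−κ‖x‖₁}` ⟹ `Σ' |k x|·‖x‖₁ⁿ ≤ M·n!(2∕κ)ⁿ(1 + 4∕κ)^d` -/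

section Decay

variable {k : (Fin d → ℤ) → ℝ} {M κ : ℝ}

/-- The size letter is non-negative (read off at `x = 0`). -/
theorem size_nonneg_of_decay (hdecay : ∀ x : Fin d → ℤ, |k x| ≤ M * exp (-κ * ∑ j, |(x j : ℝ)|)) : 0 ≤ M := by
  have h := hdecay 0
  simp only [Pi.zero_apply, Int.cast_zero, abs_zero, sum_const_zero, mul_zero, exp_zero, mul_one] at h
  exact (abs_nonneg _).trans h

/-- **FINITE PARTIAL SUMS OF THE KERNEL's ISOTROPIC MOMENTS** under the decay letter `(M, κ)`:
`Σ_{x ∈ S} |k x|·‖x‖₁ⁿ ≤ M·n!(2∕κ)ⁿ(1 + 4∕κ)^d`. [folklore] -/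
theorem sum_moment_le_of_decay (hκ : 0 < κ) (hdecay : ∀ x : Fin d → ℤ, |k x| ≤ M * exp (-κ * ∑ j, |(x j : ℝ)|))
    (n : ℕ) (S : Finset (Fin d → ℤ)) :
    ∑ x ∈ S, |k x| * (∑ j, |(x j : ℝ)|) ^ n ≤ M * (n ! * (2 / κ) ^ n * (1 + 4 / κ) ^ d) := by
  have hM : 0 ≤ M := size_nonneg_of_decay hdecay
  calc ∑ x ∈ S, |k x| * (∑ j, |(x j : ℝ)|) ^ n
      ≤ ∑ x ∈ S, M * ((∑ j, |(x j : ℝ)|) ^ n * exp (-κ * ∑ j, |(x j : ℝ)|)) := by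
        refine sum_le_sum fun x _ => ?_
        calc |k x| * (∑ j, |(x j : ℝ)|) ^ n ≤ M * exp (-κ * ∑ j, |(x j : ℝ)|) * (∑ j, |(x j : ℝ)|) ^ n :=
            mul_le_mul_of_nonneg_right (hdecay x) (by positivity)
          _ = M * ((∑ j, |(x j : ℝ)|) ^ n * exp (-κ * ∑ j, |(x j : ℝ)|)) := by ring
    _ = M * ∑ x ∈ S, (∑ j, |(x j : ℝ)|) ^ n * exp (-κ * ∑ j, |(x j : ℝ)|) := by rw [mul_sum]
    _ ≤ M * (n ! * (2 / κ) ^ n * (1 + 4 / κ) ^ d) :=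
        mul_le_mul_of_nonneg_left (sum_norm1_pow_mul_exp_neg_le hκ n S) hM

/-- **THE KERNEL's ISOTROPIC MOMENTS BY VALUE**: `Σ'_{x ∈ ℤ^d} |k x|·‖x‖₁ⁿ ≤ M·n!(2∕κ)ⁿ(1 + 4∕κ)^d` (the value behind
`…LatticeKernelDecayMoments.summable_moment_of_decay_pi`). [folklore] -/
theorem tsum_moment_le_of_decay (hκ : 0 < κ) (hdecay : ∀ x : Fin d → ℤ, |k x| ≤ M * exp (-κ * ∑ j, |(x j : ℝ)|))
    (n : ℕ) : ∑' x : Fin d → ℤ, |k x| * (∑ j, |(x j : ℝ)|) ^ n ≤ M * (n ! * (2 / κ) ^ n * (1 + 4 / κ) ^ d) :=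
  Real.tsum_le_of_sum_le (fun x => by positivity) (sum_moment_le_of_decay hκ hdecay n)

/-- **THE KERNEL's DIRECTIONAL MOMENTS BY VALUE**: with frequencies `ω x = Σ_j x_j e_j`, `|e_j| ≤ E`, `0 ≤ E`:
`Σ'_{x ∈ ℤ^d} |k x|·|ω x|ⁿ ≤ Eⁿ·M·n!(2∕κ)ⁿ(1 + 4∕κ)^d` (the value behind `…LatticeKernelDecayMoments.summable_directional_moment_of_decay_pi`;
`|ω x| ≤ E‖x‖₁` is its `abs_sum_mul_le`). [folklore] -/
theorem tsum_directional_moment_le_of_decay (hκ : 0 < κ)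
    (hdecay : ∀ x : Fin d → ℤ, |k x| ≤ M * exp (-κ * ∑ j, |(x j : ℝ)|)) {e : Fin d → ℝ} {E : ℝ} (hE : 0 ≤ E)
    (he : ∀ j, |e j| ≤ E) (n : ℕ) :
    ∑' x : Fin d → ℤ, |k x| * |∑ j, (x j : ℝ) * e j| ^ n ≤ E ^ n * M * (n ! * (2 / κ) ^ n * (1 + 4 / κ) ^ d) := by
  refine Real.tsum_le_of_sum_le (fun x => by positivity) fun S => ?_
  calc ∑ x ∈ S, |k x| * |∑ j, (x j : ℝ) * e j| ^ n
      ≤ ∑ x ∈ S, E ^ n * (|k x| * (∑ j, |(x j : ℝ)|) ^ n) := by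
        refine sum_le_sum fun x _ => ?_
        have hω : |∑ j, (x j : ℝ) * e j| ≤ E * ∑ j, |(x j : ℝ)| := abs_sum_mul_le he x
        calc |k x| * |∑ j, (x j : ℝ) * e j| ^ n ≤ |k x| * (E * ∑ j, |(x j : ℝ)|) ^ n :=
            mul_le_mul_of_nonneg_left (pow_le_pow_left₀ (abs_nonneg _) hω n) (abs_nonneg _)
          _ = E ^ n * (|k x| * (∑ j, |(x j : ℝ)|) ^ n) := by rw [mul_pow]; ring
    _ = E ^ n * ∑ x ∈ S, |k x| * (∑ j, |(x j : ℝ)|) ^ n := by rw [mul_sum]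
    _ ≤ E ^ n * (M * (n ! * (2 / κ) ^ n * (1 + 4 / κ) ^ d)) :=
        mul_le_mul_of_nonneg_left (sum_moment_le_of_decay hκ hdecay n S) (pow_nonneg hE n)
    _ = E ^ n * M * (n ! * (2 / κ) ^ n * (1 + 4 / κ) ^ d) := by ring

/-! ## §4 The END in `…LatticeKernelMomentsSummable`'s currency: the derivative letters of the symbol BY VALUE from `(M, κ)` -/

/-- **THE `n`-TH DERIVATIVE LETTER BY VALUE FROM THE DECAY**: for the symbol `Φ(t) = Σ'_{x ∈ ℤ^d} k x·cos(ω x·t)`, `ω x = Σ_j x_j e_j`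
(`|e_j| ≤ E`, `0 ≤ E`), under `|k x| ≤ M e^{−κ‖x‖₁}` (`κ > 0`): `|Φ⁽ⁿ⁾(t)| ≤ Eⁿ·M·n!(2∕κ)ⁿ(1 + 4∕κ)^d` for EVERY `n` and `t` —
`…LatticeKernelMomentsSummable.abs_iteratedDeriv_symbol_le` BY NAME (its `hmom` from `…LatticeKernelDecayMoments.moments_of_decay_pi`)
composed with §3. [folklore] -/
theorem abs_iteratedDeriv_symbol_le_of_decay (hκ : 0 < κ)
    (hdecay : ∀ x : Fin d → ℤ, |k x| ≤ M * exp (-κ * ∑ j, |(x j : ℝ)|)) {e : Fin d → ℝ} {E : ℝ} (hE : 0 ≤ E)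
    (he : ∀ j, |e j| ≤ E) (n : ℕ) (t : ℝ) :
    |iteratedDeriv n (fun t : ℝ => ∑' x : Fin d → ℤ, k x * cos ((∑ j, (x j : ℝ) * e j) * t)) t|
      ≤ E ^ n * M * (n ! * (2 / κ) ^ n * (1 + 4 / κ) ^ d) :=
  (abs_iteratedDeriv_symbol_le (ω := fun x : Fin d → ℤ => ∑ j, (x j : ℝ) * e j) (N := n)
      (moments_of_decay_pi hκ hdecay he n) le_rfl t).trans
    (tsum_directional_moment_le_of_decay hκ hdecay hE he n)

/-- **THE (D) LETTER `K₄` BY VALUE**: `|Φ⁗(t)| ≤ 384·E⁴·M·κ⁻⁴·(1 + 4∕κ)^d` (`4!·2⁴ = 384`) — the fourth-derivative letter of an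
inherited kernel FROM ITS LOCALITY `(M, κ)`, the junction `…InheritedHessianPowerCounting`'s NOT-HERE names («`K₄` … the fourth moment of
its position-space kernel, finite by a tree decay `e^{−κd}`»). [folklore] -/
theorem abs_iteratedDeriv_four_symbol_le_of_decay (hκ : 0 < κ)
    (hdecay : ∀ x : Fin d → ℤ, |k x| ≤ M * exp (-κ * ∑ j, |(x j : ℝ)|)) {e : Fin d → ℝ} {E : ℝ} (hE : 0 ≤ E)
    (he : ∀ j, |e j| ≤ E) (t : ℝ) :
    |iteratedDeriv 4 (fun t : ℝ => ∑' x : Fin d → ℤ, k x * cos ((∑ j, (x j : ℝ) * e j) * t)) t|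
      ≤ 384 * E ^ 4 * M * κ⁻¹ ^ 4 * (1 + 4 / κ) ^ d := by
  have h := abs_iteratedDeriv_symbol_le_of_decay hκ hdecay hE he 4 t
  have e4 : E ^ 4 * M * ((4 ! : ℕ) * (2 / κ) ^ 4 * (1 + 4 / κ) ^ d) = 384 * E ^ 4 * M * κ⁻¹ ^ 4 * (1 + 4 / κ) ^ d := by
    rw [show (4 ! : ℕ) = 24 by rfl, div_eq_mul_inv, mul_pow]
    push_cast
    ring
  rw [e4] at h
  exact h

/-- **THE SUBTRACTED LETTER BY VALUE**: under the decay `(M, κ)`, the direction `(e, E)` and the Ward letter `Σ' k x = 0`, for every `t`: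
`|Φ(t) + ½(Σ' k x·(ω x)²)·t²| ≤ 16·E⁴·M·κ⁻⁴·(1 + 4∕κ)^d · t⁴` (`= (K₄∕24)·t⁴`) — `…LatticeKernelMomentsSummable.abs_symbol_sub_marginal_le`
BY NAME with its fourth moment valued by §3; the shape of `…InheritedHessianPowerCounting` §6's remainder letter `|Rₙ q| ≤ C‖q‖⁴` with
`C` NAMED from `(M, κ, E, d)`. [folklore] -/
theorem abs_symbol_sub_marginal_le_of_decay_pi (hκ : 0 < κ)
    (hdecay : ∀ x : Fin d → ℤ, |k x| ≤ M * exp (-κ * ∑ j, |(x j : ℝ)|)) {e : Fin d → ℝ} {E : ℝ} (hE : 0 ≤ E)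
    (he : ∀ j, |e j| ≤ E) (hW : ∑' x : Fin d → ℤ, k x = 0) (t : ℝ) :
    |(∑' x : Fin d → ℤ, k x * cos ((∑ j, (x j : ℝ) * e j) * t))
        + 1 / 2 * (∑' x : Fin d → ℤ, k x * (∑ j, (x j : ℝ) * e j) ^ 2) * t ^ 2|
      ≤ 16 * E ^ 4 * M * κ⁻¹ ^ 4 * (1 + 4 / κ) ^ d * t ^ 4 := by
  have h := abs_symbol_sub_marginal_le (ω := fun x : Fin d → ℤ => ∑ j, (x j : ℝ) * e j)
    (moments_of_decay_pi hκ hdecay he 4) hW t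
  have h4 := tsum_directional_moment_le_of_decay hκ hdecay hE he 4
  have e4 : E ^ 4 * M * ((4 ! : ℕ) * (2 / κ) ^ 4 * (1 + 4 / κ) ^ d) / 24 = 16 * E ^ 4 * M * κ⁻¹ ^ 4 * (1 + 4 / κ) ^ d := by
    rw [show (4 ! : ℕ) = 24 by rfl, div_eq_mul_inv (2 : ℝ), mul_pow]
    push_cast
    ring
  calc _ ≤ (∑' x : Fin d → ℤ, |k x| * |∑ j, (x j : ℝ) * e j| ^ 4) / 24 * t ^ 4 := h
    _ ≤ E ^ 4 * M * ((4 ! : ℕ) * (2 / κ) ^ 4 * (1 + 4 / κ) ^ d) / 24 * t ^ 4 := by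
        gcongr
    _ = 16 * E ^ 4 * M * κ⁻¹ ^ 4 * (1 + 4 / κ) ^ d * t ^ 4 := by rw [e4]

end Decay

/-! ## §5 Toys (kernel): the values are not vacuous -/

/-- Toy: `d = 0` — the only point of `ℤ⁰` is the origin, `‖0‖₁ = 0`, and §1 reads `1 ≤ 1`. -/
example : ∑' x : Fin 0 → ℤ, exp (-1 * ∑ j, |(x j : ℝ)|) ≤ (1 + 2 / 1) ^ 0 := tsum_exp_neg_norm1_le one_pos

/-- Toy: on `ℤ²` the kernel `½e^{−‖x‖₁}` (`M = ½`, `κ = 1`) has fourth isotropic moment `≤ ½·4!·2⁴·5² = 4800`. -/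
example : ∑' x : Fin 2 → ℤ, |(1 / 2 : ℝ) * exp (-1 * ∑ j, |(x j : ℝ)|)| * (∑ j, |(x j : ℝ)|) ^ 4 ≤ 4800 := by
  have h := tsum_moment_le_of_decay (d := 2) (k := fun x : Fin 2 → ℤ => (1 / 2 : ℝ) * exp (-1 * ∑ j, |(x j : ℝ)|))
    (M := 1 / 2) one_pos (fun x => ?_) 4
  · have e : (1 / 2 : ℝ) * ((4 ! : ℕ) * (2 / 1) ^ 4 * (1 + 4 / 1) ^ 2) = 4800 := by
      rw [show (4 ! : ℕ) = 24 by rfl]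
      norm_num
    rw [e] at h
    exact h
  · rw [abs_of_nonneg (by positivity)]

end Summit.QuantumFields.BalabanUV.T4Continuum.NE7b.LatticeKernelMomentValues

end
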